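import Mathlib
import Summits.Ventures.PercRepro2.Defs
import Summits.Ventures.PercRepro2.Graph
import Summits.Ventures.PercRepro2.Events
import Summits.Ventures.PercRepro2.Harris
import Summits.Ventures.PercRepro2.XWForm

/-!
# The cross W-form (XW) with coincident marks (PercRepro2, p2 g23)

`XW(p) = xwBil p p = P(aλ) + P(Sa)P(Sλ) − P(a)P(λ) − P(S)P(Saλ)` with `a = {s ↔ u}`,
`λ = {y ↔ o}`, `S = {s ↔ y}` (XWForm.lean).  When two marks coincide:

* `s = u` (`a = Ω`) or `y = o` (`λ = Ω`): `XW = 0` exactly (the two trivial tight families of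
  record P2-G22-WFORM.md §1);
* `u = y` (`a = S`): `XW = P(Sλ) − P(S)P(λ) = Cov(S, λ) ≥ 0`, and `o = s` (`λ = S`):
  `XW = P(Sa) − P(S)P(a) = Cov(S, a) ≥ 0` — Harris.

So (XW) holds whenever one of the four coincidences `s = u`, `y = o`, `u = y`, `o = s` occurs (the
remaining coincidences `s = y` and `u = o` are genuine: `s = y` is the case `S = Ω`, where (XW)
reads `P(aλ) ≥ P(a)P(λ)`, Harris; `u = o` is the three-point inequality of record P2-G23-XW.md).
Own work; standard axioms.
-/

namespace Summit.Ventures.PercRepro2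

namespace XWCoincide

variable {V : Type*} {E : Type*} [Fintype E] [DecidableEq E]
  {R : Type*} [CommRing R] [LinearOrder R] [IsStrictOrderedRing R]

omit [Fintype E] [DecidableEq E] in
/-- A vertex is connected to itself: `connEvent v v = Ω`. -/
lemma connEvent_self (ends : E → Sym2 V) (v : V) : connEvent ends v v = Set.univ :=
  Set.eq_univ_of_forall fun ω => conn_refl ends ω v

omit [LinearOrder R] [IsStrictOrderedRing R] in
/-- **`s = u`**: `a = Ω` and `XW = P(λ) + P(S)P(Sλ) − P(λ) − P(S)P(Sλ) = 0`. -/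
theorem xwBil_eq_zero_of_s_eq_u (ends : E → Sym2 V) (s y o : V) (p : E → R) :
    xwBil ends s y o s p p = 0 := by
  unfold xwBil
  rw [connEvent_self, Set.univ_inter, Set.inter_univ, prob_univ]
  ring

omit [LinearOrder R] [IsStrictOrderedRing R] in
/-- **`y = o`**: `λ = Ω` and `XW = P(a) + P(Sa)P(S) − P(a) − P(S)P(Sa) = 0`. -/
theorem xwBil_eq_zero_of_y_eq_o (ends : E → Sym2 V) (s y u : V) (p : E → R) :
    xwBil ends s y y u p p = 0 := by
  unfold xwBil
  rw [connEvent_self, Set.inter_univ, Set.inter_univ, Set.inter_univ, prob_univ]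
  ring

/-- **`u = y`**: `a = S` and `XW = P(Sλ) − P(S)P(λ) = Cov(S, λ) ≥ 0` (Harris). -/
theorem xwBil_nonneg_of_u_eq_y (ends : E → Sym2 V) (s y o : V) {p : E → R} (hp : IsProbVec p) :
    0 ≤ xwBil ends s y o y p p := by
  unfold xwBil
  rw [Set.inter_self]
  have h := prob_mul_prob_le_prob_inter hp (isUpperSet_connEvent ends s y)
    (isUpperSet_connEvent ends y o)
  linarith

/-- **`o = s`**: `λ = S` and `XW = P(Sa) − P(S)P(a) = Cov(S, a) ≥ 0` (Harris). -/
theorem xwBil_nonneg_of_o_eq_s (ends : E → Sym2 V) (s y u : V) {p : E → R} (hp : IsProbVec p) :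
    0 ≤ xwBil ends s y s u p p := by
  unfold xwBil
  rw [connEvent_comm ends y s, Set.inter_self,
    show connEvent ends s y ∩ connEvent ends s u ∩ connEvent ends s y =
      connEvent ends s y ∩ connEvent ends s u from by
        rw [Set.inter_right_comm, Set.inter_self],
    Set.inter_comm (connEvent ends s u) (connEvent ends s y)]
  have h := prob_mul_prob_le_prob_inter hp (isUpperSet_connEvent ends s y)
    (isUpperSet_connEvent ends s u)
  linarith

end XWCoincide

end Summit.Ventures.PercRepro2
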